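import Literature.Topology.FourManifolds.LatticeFormsNegTwoDVectorOrthogonal
import Literature.Topology.FourManifolds.LatticeFormsStableEquivalence
import Literature.Topology.FourManifolds.LatticeFormsIndefiniteProofs
import Literature.AlgebraicGeometry.Surfaces.EnriquesInvolutionK3Lattice
import HarnessLib

/-!
# `M = M(1/2)(2)` for a `2`-elementary lattice with `a = rk M`, the even `2`-elementary lattices of rank `2` and
# signature `0` (`U`, `U(2)`, `⟨2⟩ ⊕ ⟨−2⟩`), and GHS's `S_r`
# (Alexeev–Nikulin, *Del Pezzo and K3 surfaces*, §9.2; Gritsenko–Hulek–Sankaran, arXiv:math/0607339 §4 proof of Prop. 4.6)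

Trunk T-4MAN vocabulary; sequel of `LatticeFormsNegTwoDVectorOrthogonal.lean` (row g40-#4: GHS Prop. 4.6 for `L_r`) and of
`LatticeFormsTwoElementary.lean` (Alexeev–Nikulin's invariants `(r, a, δ)`, `Λ(1/2) = halfForm`). Written for lane
`lit-hodgefound` (Track 2 foundations; prover seat `lit-hodgefound-p18`, gen 40, row g40-#5). THEOREMS ONLY — no
definition, no named fact, no instance, no notation.

## Sources, verbatim

* Alexeev–Nikulin §9.2 (held text `paper:arxiv-math_0406536` p0052): "If `δ = 0`, then `M(1/2)` will be an even
  unimodular lattice" (for `a = rk M`: the proof of the necessity of condition 7); "If `rk M ≤ 2`, then `M` is one of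
  lattices: `⟨±2⟩`, `⟨±2⟩ ⊕ ⟨±2⟩`, `U` or `U(2)`."
* Gritsenko–Hulek–Sankaran, arXiv:math/0607339 §4, proof of Prop. 4.6 (p0015): "If `div(r) = 2d` then `L_r` and `S_r`
  are isomorphic to the unique unimodular lattices of signatures `(2,18)` and `(1,1)` respectively: that is,
  `L_r ≅ 2U ⊕ 2E₈(−1)` and `S_r ≅ U`. […] In particular, for an indefinite lattice `S_r` of rank `2` and determinant `4`
  we have `S_r ≅ U(2)` if `δ_{S_r} = 0`, `⟨2⟩ ⊕ ⟨−2⟩` if `δ_{S_r} = 1`."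

## What is here (all proved)

* §1 (`LinearMap.BilinForm`, any lattice `Λ = (P, B)`): `Equivalent.smul` (`Λ ≅ Λ' ⟹ Λ(m) ≅ Λ'(m)`),
  `IsTwoElementary.isUnimodular_halfForm` (`Λ` nondegenerate `2`-elementary with all values even ⟹ `Λ(1/2)`
  unimodular), `IsTwoElementary.two_dvd_apply_of_natCard_eq_two_pow_finrank` / `…_of_length_eq_finrank`
  (`a = rk Λ ⟹` all values even — the steps of p18's `eight_dvd_signature_of_natCard_eq_two_pow_finrank` made public),
  `equivalent_two_smul_halfForm` (`Λ ≅ Λ(1/2)(2)`), `IsTwoElementary.isEven_halfForm_iff` (`Λ(1/2)` even ⟺ `δ(Λ) = 0`).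
* §2 rank `2`, signature `0`: `IsTwoElementary.length_ne_one_of_eight_dvd_signature` (condition 5),
  `invariants_one_smul_mul_prod_neg_one_smul_mul` (`⟨1⟩ ⊕ ⟨−1⟩`), `invariants_hyperbolicSum_one` (`U`),
  `equivalent_hyperbolicSum_one_of_length_eq_zero` (`a = 0 ⟹ Λ ≅ U`),
  `IsTwoElementary.equivalent_two_smul_hyperbolicSum_one` (`a = 2, δ = 0 ⟹ Λ ≅ U(2)`),
  `IsTwoElementary.equivalent_two_smul_one_prod_two_smul_neg_one` (`a = 2, δ = 1 ⟹ Λ ≅ ⟨2⟩ ⊕ ⟨−2⟩`),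
  **`IsTwoElementary.equivalent_of_finrank_eq_two_of_signature_eq_zero`** (the trichotomy).
* §3 (`Literature.Topology.FourManifolds`, setting of the predecessor, ANY even unimodular `Λ`):
  `invariants_restrict_orthogonal_orthogonal_span_pair_of_neg_vector` (`S_r`: nondegenerate, even, `2`-elementary,
  rank `2`, `σ = 0`, `ℓ(S_r) = ℓ(L_r)`, `δ(S_r) = δ(L_r)`),
  **`restrict_orthogonal_orthogonal_span_pair_equivalent_hyperbolicSum_one`** (`div(r) = 2d ⟹ S_r ≅ U`),
  **`restrict_orthogonal_orthogonal_span_pair_equivalent_of_not_two_mul_dvd`** (`div(r) = d ⟹ S_r ≅ U(2)` if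
  `δ(L_r) = 0`, `≅ ⟨2⟩ ⊕ ⟨−2⟩` if `δ(L_r) = 1`, and the disjunction).

Models: `U = hyperbolicSum 1`, `U(2) = (2 : ℤ) • hyperbolicSum 1`,
`⟨2⟩ ⊕ ⟨−2⟩ = BilinForm.prod ((2:ℤ) • ((1:ℤ) • LinearMap.mul ℤ ℤ)) ((2:ℤ) • ((-1:ℤ) • LinearMap.mul ℤ ℤ))` (as in
`LatticeFormsTwoElementaryInvariants.invariants_two_smul_smul_mul_prod`); `(Λ₁ ⊕ Λ₂)(m) = Λ₁(m) ⊕ Λ₂(m)` is the tree's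
`Literature.AlgebraicGeometry.Surfaces.smul_prod` (imported, not restated).

## References

* [AlexeevNikulin2006] V. Alexeev, V. V. Nikulin, Del Pezzo and K3 surfaces, MSJ Memoirs 15 (2006)
  (arXiv:math/0406536), §9.1.1, §9.2 (Thm. 9.9 and the list of `2`-elementary lattices of rank `≤ 2`).
* [GritsenkoHulekSankaran2007Kodaira] V. Gritsenko, K. Hulek, G. K. Sankaran, The Kodaira dimension of the moduli of
  K3 surfaces, Invent. Math. 169 (2007) 519–567 (arXiv:math/0607339), §4 (arXiv numbering) proof of Prop. 4.6.
* [Nikulin1980] V. V. Nikulin, Integral symmetric bilinear forms and some of their applications, Math. USSR Izv. 14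
  (1980) 103–167, Thm. 3.6.2.
* [Serre1973] J.-P. Serre, A Course in Arithmetic, GTM 7, Springer 1973, Ch. V §2.2 Thm. 5 (indefinite unimodular
  lattices are classified by rank, signature and type).
* [Huybrechts2016K3] D. Huybrechts, Lectures on K3 Surfaces, CUP 2016, Ch. 14 §0.2 Prop. 0.2, §0.3.
-/

noncomputable section

open Module Function
open LinearMap (BilinForm)
open scoped Pointwise

namespace LinearMap.BilinForm

/-! ### §1 Twisting an isometry; `Λ = Λ(1/2)(2)` with `Λ(1/2)` unimodular when `Λ` is `2`-elementary with even values -/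

section Half

variable {P : Type*} [AddCommGroup P] (B : BilinForm ℤ P) {P' : Type*} [AddCommGroup P'] (B' : BilinForm ℤ P')

variable {B B'} in
/-- **`Λ ≅ Λ' ⟹ Λ(m) ≅ Λ'(m)`**: an isometry is an isometry of the twisted lattices. [cite: AlexeevNikulin2006, §9.1.1 ("the lattice obtained from `M` by multiplying the form of `M` by `a`")] -/
theorem Equivalent.smul (h : B.Equivalent B') (m : ℤ) : (m • B).Equivalent (m • B') := by
  obtain ⟨e⟩ := h
  exact ⟨{ e.toLinearEquiv with
    map_app' := fun x y ↦ by
      change (m • B') (e x) (e y) = (m • B) x y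
      rw [smul_apply_apply, smul_apply_apply, e.map_app] }⟩

variable [Module.Finite ℤ P] [Module.Free ℤ P]

/-- **`Λ(1/2)` is unimodular** when `Λ` is nondegenerate and `2`-elementary with all values even: every `g ∈ Λ^*`
has `2g = (x.·)_Λ = 2(x.·)_{Λ(1/2)}` ("`M = M'(2)` with `M'` unimodular"). [cite: AlexeevNikulin2006, §9.2 ("`M(1/2)` will be an even unimodular lattice"), §9.1 eq. (9.5)] -/
theorem IsTwoElementary.isUnimodular_halfForm (h2 : B.IsTwoElementary) (hB : B.Nondegenerate)
    (h : ∀ x y, (2 : ℤ) ∣ B x y) : (B.halfForm h).IsUnimodular := by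
  have h2x : ∀ x, B x = (2 : ℤ) • B.halfForm h x := fun x ↦ by
    conv_lhs => rw [← B.two_smul_halfForm h]
    rfl
  refine LinearMap.IsPerfPair.of_bijective _ ⟨fun x y hxy ↦ ?_, fun g ↦ ?_⟩
  · apply B.injective_of_nondegenerate hB
    rw [h2x, h2x, hxy]
  · obtain ⟨x, hx⟩ : (2 : ℤ) • g ∈ LinearMap.range B := (B.isTwoElementary_iff_forall_mem_range).1 h2 g
    refine ⟨x, LinearMap.ext fun y ↦ ?_⟩
    have h1 := LinearMap.congr_fun (hx.symm.trans (h2x x)) y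
    rw [LinearMap.smul_apply, LinearMap.smul_apply, smul_eq_mul, smul_eq_mul] at h1
    exact (mul_left_cancel₀ two_ne_zero h1).symm

/-- **All values of a `2`-elementary `Λ` with `|A_Λ| = 2^{rk Λ}` (i.e. `a = rk Λ`) are even**: `i_Λ(Λ) ⊇ 2Λ^*` has the
same index `2^{rk Λ}` in `Λ^*` as `2Λ^*`, so `i_Λ(Λ) = 2Λ^*`. [cite: AlexeevNikulin2006, §9.2 (proof of the necessity of condition 7: "`M(1/2)` will be an even unimodular lattice")] -/
theorem IsTwoElementary.two_dvd_apply_of_natCard_eq_two_pow_finrank (h2 : B.IsTwoElementary)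
    (hcard : Nat.card B.discriminantGroup = 2 ^ finrank ℤ P) (x y : P) : (2 : ℤ) ∣ B x y := by
  classical
  have hle : (2 : ℤ) • (⊤ : Submodule ℤ (Module.Dual ℤ P)) ≤ LinearMap.range B := by
    intro g hg
    obtain ⟨f, -, rfl⟩ := (Submodule.mem_smul_pointwise_iff_exists g (2 : ℤ) ⊤).1 hg
    exact (B.isTwoElementary_iff_forall_mem_range).1 h2 f
  have hge : LinearMap.range B ≤ (2 : ℤ) • (⊤ : Submodule ℤ (Module.Dual ℤ P)) := by
    let b := Module.Free.chooseBasis ℤ P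
    have i1 : ((2 : ℤ) • (⊤ : Submodule ℤ (Module.Dual ℤ P))).toAddSubgroup.index = 2 ^ finrank ℤ P := by
      change Nat.card (Module.Dual ℤ P ⧸ (2 : ℤ) • (⊤ : Submodule ℤ (Module.Dual ℤ P))) = _
      rw [natCard_quotient_smul_top b.dualBasis 2, Module.finrank_eq_card_chooseBasisIndex]
      norm_num
    have i2 : (LinearMap.range B).toAddSubgroup.index = 2 ^ finrank ℤ P := hcard
    have hri := AddSubgroup.relIndex_mul_index
      (H := ((2 : ℤ) • (⊤ : Submodule ℤ (Module.Dual ℤ P))).toAddSubgroup) (K := (LinearMap.range B).toAddSubgroup)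
      (fun g hg ↦ hle hg)
    rw [i1, i2] at hri
    have h1 : ((2 : ℤ) • (⊤ : Submodule ℤ (Module.Dual ℤ P))).toAddSubgroup.relIndex
        (LinearMap.range B).toAddSubgroup = 1 :=
      Nat.eq_of_mul_eq_mul_right (pow_pos two_pos _) (hri.trans (one_mul _).symm)
    exact fun g hg ↦ (AddSubgroup.relIndex_eq_one.1 h1) hg
  obtain ⟨g, -, hg⟩ := (Submodule.mem_smul_pointwise_iff_exists _ _ _).1 (hge (LinearMap.mem_range_self B x))
  exact ⟨g y, by rw [← hg, LinearMap.smul_apply, smul_eq_mul]⟩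

/-- The same with the hypothesis `ℓ(Λ) = rk Λ` (`|A_Λ| = 2^{ℓ(Λ)}` for a `2`-elementary `Λ`). [cite: AlexeevNikulin2006, §9.2] -/
theorem IsTwoElementary.two_dvd_apply_of_length_eq_finrank (h2 : B.IsTwoElementary) (hB : B.Nondegenerate)
    (hℓ : B.length = finrank ℤ P) (x y : P) : (2 : ℤ) ∣ B x y :=
  h2.two_dvd_apply_of_natCard_eq_two_pow_finrank B (by rw [h2.natCard_eq_two_pow_length B hB, hℓ]) x y

omit [Module.Finite ℤ P] [Module.Free ℤ P] in
/-- **`Λ ≅ Λ(1/2)(2)`** (equality of forms `2·(Λ(1/2)) = Λ`, as an equivalence for transporting invariants).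
[cite: AlexeevNikulin2006, §9.1.1] -/
theorem equivalent_two_smul_halfForm (h : ∀ x y, (2 : ℤ) ∣ B x y) : B.Equivalent ((2 : ℤ) • B.halfForm h) := by
  rw [B.two_smul_halfForm h]

/-- **`δ(Λ) = 0 ⟺ Λ(1/2)` is even** (for `Λ` nondegenerate even `2`-elementary with all values even, so that
`Λ(1/2)` is unimodular): "If `δ = 0`, then `M(1/2)` will be an even unimodular lattice"; conversely `δ(Λ'(2)) = 0`
for `Λ'` even unimodular and `δ(Λ'(2)) = 1` for `Λ'` odd unimodular. [cite: AlexeevNikulin2006, §9.2] [cite: Huybrechts2016K3, Ch. 14 §0.3 (iv)] -/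
theorem IsTwoElementary.isEven_halfForm_iff (h2 : B.IsTwoElementary) (hB : B.Nondegenerate) (hs : B.IsSymm)
    (he : B.IsEven) (h : ∀ x y, (2 : ℤ) ∣ B x y) :
    (B.halfForm h).IsEven ↔ B.deltaInvariant hB hs he = 0 := by
  have hu' := h2.isUnimodular_halfForm B hB h
  have hB2 : ((2 : ℤ) • B.halfForm h).Nondegenerate := by rw [B.two_smul_halfForm h]; exact hB
  have hs2 : ((2 : ℤ) • B.halfForm h).IsSymm := by rw [B.two_smul_halfForm h]; exact hs
  have he2 : ((2 : ℤ) • B.halfForm h).IsEven := by rw [B.two_smul_halfForm h]; exact he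
  have hδ : B.deltaInvariant hB hs he = ((2 : ℤ) • B.halfForm h).deltaInvariant hB2 hs2 he2 :=
    (deltaInvariant_eq_of_equivalent (B.equivalent_two_smul_halfForm h) hB hs he hB2 hs2 he2).symm
  rw [hδ]
  constructor
  · intro he'
    exact deltaInvariant_two_smul_eq_zero_of_isEven _ hu' he' hB2 hs2 he2
  · intro h0
    by_contra ho
    have h1 := deltaInvariant_two_smul_eq_one_of_isOdd _ hu' ho hB2 hs2 he2
    omega

end Half

/-! ### §2 Even `2`-elementary lattices of rank `2` and signature `0`: `U`, `U(2)`, `⟨2⟩ ⊕ ⟨−2⟩` -/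

section RankTwo

variable {P : Type*} [AddCommGroup P] [Module.Finite ℤ P] [Module.Free ℤ P] (B : BilinForm ℤ P)

/-- **`a ≠ 1` when `8 ∣ σ`** (Nikulin's condition 5: `a = 1 ⟹ σ ≡ ±1 (mod 8)`); in particular for signature `0`.
[cite: AlexeevNikulin2006, §9.2 Thm. 9.9 (condition 5)] [cite: Nikulin1980, Thm. 3.6.2] -/
theorem IsTwoElementary.length_ne_one_of_eight_dvd_signature (h2 : B.IsTwoElementary) (hB : B.Nondegenerate)
    (hs : B.IsSymm) (he : B.IsEven) (h8 : (8 : ℤ) ∣ B.signature) : B.length ≠ 1 := by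
  intro h1
  obtain ⟨-, -, -, -, h5, -⟩ := h2.nikulin_necessary_conditions B hB hs he
  rcases h5 h1 with h | h <;> omega

/-- **`⟨1⟩ ⊕ ⟨−1⟩` is symmetric, odd, unimodular, of rank `2` and signature `0`** (so indefinite).
[cite: Serre1973, Ch. V §2.2 Thm. 5 (the odd indefinite case `I₊ ⊕ I₋`)] [cite: Huybrechts2016K3, Ch. 14 Cor. 1.3 (ii)] -/
theorem invariants_one_smul_mul_prod_neg_one_smul_mul :
    (BilinForm.prod ((1 : ℤ) • LinearMap.mul ℤ ℤ) ((-1 : ℤ) • LinearMap.mul ℤ ℤ)).IsSymm ∧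
    (BilinForm.prod ((1 : ℤ) • LinearMap.mul ℤ ℤ) ((-1 : ℤ) • LinearMap.mul ℤ ℤ)).IsOdd ∧
    (BilinForm.prod ((1 : ℤ) • LinearMap.mul ℤ ℤ) ((-1 : ℤ) • LinearMap.mul ℤ ℤ)).IsUnimodular ∧
    finrank ℤ (ℤ × ℤ) = 2 ∧
    (BilinForm.prod ((1 : ℤ) • LinearMap.mul ℤ ℤ) ((-1 : ℤ) • LinearMap.mul ℤ ℤ)).signature = 0 ∧
    (BilinForm.prod ((1 : ℤ) • LinearMap.mul ℤ ℤ) ((-1 : ℤ) • LinearMap.mul ℤ ℤ)).IsIndefinite := by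
  have h1 : (1 : ℤ) * 1 = 1 := by norm_num
  have h1' : (-1 : ℤ) * -1 = 1 := by norm_num
  have hsI : (BilinForm.prod ((1 : ℤ) • LinearMap.mul ℤ ℤ) ((-1 : ℤ) • LinearMap.mul ℤ ℤ)).IsSymm :=
    (isSymm_smul_mul 1).prod (isSymm_smul_mul (-1))
  have huI : (BilinForm.prod ((1 : ℤ) • LinearMap.mul ℤ ℤ) ((-1 : ℤ) • LinearMap.mul ℤ ℤ)).IsUnimodular :=
    isUnimodular_prod_iff.2 ⟨isPerfPair_smul_mul h1, isPerfPair_smul_mul h1'⟩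
  have hrk : finrank ℤ (ℤ × ℤ) = 2 := by rw [Module.finrank_prod, Module.finrank_self]
  have hσ1 : ∀ {ε : ℤ}, ε * ε = 1 → BilinForm.signature (ε • LinearMap.mul ℤ ℤ) = ε := fun hε ↦ by
    rw [← signature_smul_of_pos _ two_pos]
    exact signature_two_smul_smul_mul hε
  have hσ : (BilinForm.prod ((1 : ℤ) • LinearMap.mul ℤ ℤ) ((-1 : ℤ) • LinearMap.mul ℤ ℤ)).signature = 0 := by
    rw [signature_prod _ _ (isSymm_smul_mul 1) (isSymm_smul_mul (-1)), hσ1 h1, hσ1 h1']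
    norm_num
  refine ⟨hsI, isOdd_prod_of_left (isOdd_smul_mul h1), huI, hrk, hσ, ?_⟩
  rw [isIndefinite_iff_abs_signature_lt_finrank hsI huI.nondegenerate.1, hσ, hrk]
  norm_num

/-- **`U = hyperbolicSum 1` is symmetric, even, unimodular, of rank `2`, signature `0`, indefinite.**
[cite: Serre1973, Ch. V §2.2 Thm. 5] [cite: Huybrechts2016K3, Ch. 14 §0.3 (ii)] -/
theorem invariants_hyperbolicSum_one :
    (hyperbolicSum 1).IsSymm ∧ (hyperbolicSum 1).IsEven ∧ (hyperbolicSum 1).IsUnimodular ∧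
      finrank ℤ ((Fin 1 → ℤ) × (Fin 1 → ℤ)) = 2 ∧ (hyperbolicSum 1).signature = 0 ∧ (hyperbolicSum 1).IsIndefinite :=
  ⟨isSymm_hyperbolicSum 1, isEven_hyperbolicSum 1, isUnimodular_hyperbolicSum 1,
    by rw [finrank_hyperbolicSum_carrier], signature_hyperbolicSum 1,
    Literature.Topology.FourManifolds.isIndefinite_hyperbolicSum one_pos⟩

/-- **An even `2`-elementary nondegenerate lattice of rank `2` and signature `0` with `a = 0` is `≅ U`** (unimodular,
even, indefinite: Milnor/Serre). [cite: AlexeevNikulin2006, §9.2 ("If `rk M ≤ 2`, then `M` is one of lattices: `⟨±2⟩`, `⟨±2⟩ ⊕ ⟨±2⟩`, `U` or `U(2)`")] [cite: Serre1973, Ch. V §2.2 Thm. 5] [cite: GritsenkoHulekSankaran2007Kodaira, §4 (arXiv numbering) proof of Prop. 4.6 ("`S_r ≅ U`")] -/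
theorem equivalent_hyperbolicSum_one_of_length_eq_zero (hB : B.Nondegenerate) (hs : B.IsSymm) (he : B.IsEven)
    (hrk : finrank ℤ P = 2) (hσ : B.signature = 0) (hℓ : B.length = 0) : B.Equivalent (hyperbolicSum 1) := by
  have hu := (B.length_eq_zero_iff_isUnimodular hB).1 hℓ
  have hi : B.IsIndefinite := by
    rw [isIndefinite_iff_abs_signature_lt_finrank hs hB.1, hσ, hrk]
    norm_num
  obtain ⟨hsU, heU, huU, hrkU, hσU, hiU⟩ := invariants_hyperbolicSum_one
  exact equivalent_of_isIndefinite_holds hs hu hi hsU huU hiU (by rw [hrk, hrkU]) (by rw [hσ, hσU])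
    (iff_of_true he heU)

/-- **An even `2`-elementary nondegenerate lattice `Λ` of rank `2`, signature `0`, `a = 2`, `δ = 0` is `≅ U(2)`**:
`Λ = Λ'(2)` with `Λ' = Λ(1/2)` even unimodular indefinite of rank `2`, hence `Λ' ≅ U`.
[cite: AlexeevNikulin2006, §9.2 ("`U` or `U(2)`"; "`M(1/2)` will be an even unimodular lattice")] [cite: GritsenkoHulekSankaran2007Kodaira, §4 (arXiv numbering) proof of Prop. 4.6 ("`S_r ≅ U(2)` if `δ_{S_r} = 0`")] -/
theorem IsTwoElementary.equivalent_two_smul_hyperbolicSum_one (h2 : B.IsTwoElementary) (hB : B.Nondegenerate)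
    (hs : B.IsSymm) (he : B.IsEven) (hrk : finrank ℤ P = 2) (hσ : B.signature = 0) (hℓ : B.length = 2)
    (hδ : B.deltaInvariant hB hs he = 0) : B.Equivalent ((2 : ℤ) • hyperbolicSum 1) := by
  have h : ∀ x y, (2 : ℤ) ∣ B x y := h2.two_dvd_apply_of_length_eq_finrank B hB (by rw [hℓ, hrk])
  have hu' := h2.isUnimodular_halfForm B hB h
  have he' : (B.halfForm h).IsEven := (h2.isEven_halfForm_iff B hB hs he h).2 hδ
  have hs' : (B.halfForm h).IsSymm := ⟨fun x y ↦ by rw [halfForm_apply, halfForm_apply, hs.eq]⟩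
  have hσ' : (B.halfForm h).signature = 0 := by
    rw [← signature_smul_of_pos (B.halfForm h) two_pos, B.two_smul_halfForm h]
    exact hσ
  have hi' : (B.halfForm h).IsIndefinite := by
    rw [isIndefinite_iff_abs_signature_lt_finrank hs' hu'.nondegenerate.1, hσ', hrk]
    norm_num
  obtain ⟨hsU, heU, huU, hrkU, hσU, hiU⟩ := invariants_hyperbolicSum_one
  have hU : (B.halfForm h).Equivalent (hyperbolicSum 1) :=
    equivalent_of_isIndefinite_holds hs' hu' hi' hsU huU hiU (by rw [hrk, hrkU]) (by rw [hσ', hσU])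
      (iff_of_true he' heU)
  exact (B.equivalent_two_smul_halfForm h).trans (hU.smul 2)

/-- **An even `2`-elementary nondegenerate lattice `Λ` of rank `2`, signature `0`, `a = 2`, `δ = 1` is
`≅ ⟨2⟩ ⊕ ⟨−2⟩`**: `Λ = Λ'(2)` with `Λ' = Λ(1/2)` odd unimodular indefinite of rank `2`, hence `Λ' ≅ ⟨1⟩ ⊕ ⟨−1⟩`.
[cite: AlexeevNikulin2006, §9.2 ("`⟨±2⟩ ⊕ ⟨±2⟩`"; "If `δ = 1`, then `q_M ≅ q_{±1}^{(2)}(2) ⊕ q'`")] [cite: GritsenkoHulekSankaran2007Kodaira, §4 (arXiv numbering) proof of Prop. 4.6 ("`⟨2⟩ ⊕ ⟨−2⟩` if `δ_{S_r} = 1`")] [cite: Serre1973, Ch. V §2.2 Thm. 5] -/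
theorem IsTwoElementary.equivalent_two_smul_one_prod_two_smul_neg_one (h2 : B.IsTwoElementary)
    (hB : B.Nondegenerate) (hs : B.IsSymm) (he : B.IsEven) (hrk : finrank ℤ P = 2) (hσ : B.signature = 0)
    (hℓ : B.length = 2) (hδ : B.deltaInvariant hB hs he = 1) :
    B.Equivalent (BilinForm.prod ((2 : ℤ) • ((1 : ℤ) • LinearMap.mul ℤ ℤ)) ((2 : ℤ) • ((-1 : ℤ) • LinearMap.mul ℤ ℤ))) := by
  have h : ∀ x y, (2 : ℤ) ∣ B x y := h2.two_dvd_apply_of_length_eq_finrank B hB (by rw [hℓ, hrk])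
  have hu' := h2.isUnimodular_halfForm B hB h
  have ho' : (B.halfForm h).IsOdd := fun he' ↦ by
    have := (h2.isEven_halfForm_iff B hB hs he h).1 he'
    omega
  have hs' : (B.halfForm h).IsSymm := ⟨fun x y ↦ by rw [halfForm_apply, halfForm_apply, hs.eq]⟩
  have hσ' : (B.halfForm h).signature = 0 := by
    rw [← signature_smul_of_pos (B.halfForm h) two_pos, B.two_smul_halfForm h]
    exact hσ
  have hi' : (B.halfForm h).IsIndefinite := by
    rw [isIndefinite_iff_abs_signature_lt_finrank hs' hu'.nondegenerate.1, hσ', hrk]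
    norm_num
  obtain ⟨hsI, hoI, huI, hrkI, hσI, hiI⟩ := invariants_one_smul_mul_prod_neg_one_smul_mul
  have hI : (B.halfForm h).Equivalent (BilinForm.prod ((1 : ℤ) • LinearMap.mul ℤ ℤ) ((-1 : ℤ) • LinearMap.mul ℤ ℤ)) :=
    equivalent_of_isIndefinite_holds hs' hu' hi' hsI huI hiI (by rw [hrk, hrkI]) (by rw [hσ', hσI])
      (iff_of_false ho' hoI)
  rw [← Literature.AlgebraicGeometry.Surfaces.smul_prod]
  exact (B.equivalent_two_smul_halfForm h).trans (hI.smul 2)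

/-- **The even `2`-elementary lattices of rank `2` and signature `0` are `U`, `U(2)`, `⟨2⟩ ⊕ ⟨−2⟩**, told apart by
`(a, δ) = (0, 0), (2, 0), (2, 1)` (Alexeev–Nikulin's list "`⟨±2⟩`, `⟨±2⟩ ⊕ ⟨±2⟩`, `U` or `U(2)`" in rank `2`,
signature `0`; `a = 1` is excluded by condition 5). [cite: AlexeevNikulin2006, §9.2] [cite: GritsenkoHulekSankaran2007Kodaira, §4 (arXiv numbering) proof of Prop. 4.6 ("for an indefinite lattice `S_r` of rank `2` and determinant `4` we have `S_r ≅ U(2)` if `δ_{S_r} = 0`, `⟨2⟩ ⊕ ⟨−2⟩` if `δ_{S_r} = 1`")] -/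
theorem IsTwoElementary.equivalent_of_finrank_eq_two_of_signature_eq_zero (h2 : B.IsTwoElementary)
    (hB : B.Nondegenerate) (hs : B.IsSymm) (he : B.IsEven) (hrk : finrank ℤ P = 2) (hσ : B.signature = 0) :
    (B.length = 0 ∧ B.Equivalent (hyperbolicSum 1)) ∨
    (B.length = 2 ∧ B.deltaInvariant hB hs he = 0 ∧ B.Equivalent ((2 : ℤ) • hyperbolicSum 1)) ∨
    (B.length = 2 ∧ B.deltaInvariant hB hs he = 1 ∧
      B.Equivalent (BilinForm.prod ((2 : ℤ) • ((1 : ℤ) • LinearMap.mul ℤ ℤ)) ((2 : ℤ) • ((-1 : ℤ) • LinearMap.mul ℤ ℤ)))) := by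
  have hle : B.length ≤ 2 := hrk ▸ B.length_le_finrank
  have hne := h2.length_ne_one_of_eight_dvd_signature B hB hs he (by rw [hσ]; exact dvd_zero 8)
  rcases Nat.lt_or_ge B.length 1 with h0 | h1
  · exact Or.inl ⟨by omega, B.equivalent_hyperbolicSum_one_of_length_eq_zero hB hs he hrk hσ (by omega)⟩
  · have hℓ : B.length = 2 := by omega
    rcases B.deltaInvariant_eq_zero_or_eq_one hB hs he with hδ | hδ
    · exact Or.inr (Or.inl ⟨hℓ, hδ, h2.equivalent_two_smul_hyperbolicSum_one B hB hs he hrk hσ hℓ hδ⟩)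
    · exact Or.inr (Or.inr ⟨hℓ, hδ, h2.equivalent_two_smul_one_prod_two_smul_neg_one B hB hs he hrk hσ hℓ hδ⟩)

end RankTwo

end LinearMap.BilinForm

/-! ### §3 GHS's `S_r = (L_r)^⊥`: `≅ U` (`div(r) = 2d`), `≅ U(2)` or `⟨2⟩ ⊕ ⟨−2⟩` (`div(r) = d`) -/

namespace Literature.Topology.FourManifolds

open LinearMap.BilinForm

universe u

variable {M : Type u} [AddCommGroup M] [Module.Free ℤ M] [Module.Finite ℤ M] (B : BilinForm ℤ M)

/-- **The invariants of `S_r`** for an even unimodular `Λ`, `ℓ` primitive with `ℓ² = 2d > 0`, `r ⊥ ℓ` primitive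
with `r² = −2d` and `d ∣ (r, ℓ^⊥)`: `S_r = ({ℓ, r}^⊥)^⊥` is nondegenerate, even, `2`-elementary, of rank `2` and
signature `0`, with `ℓ(S_r) = ℓ(L_r)` and `δ(S_r) = δ(L_r)` ("`L_r` and `S_r` have the same determinant";
`(A_{S_r}, q) ≅ (A_{L_r}, −q)`). [cite: GritsenkoHulekSankaran2007Kodaira, §4 (arXiv numbering) proof of Prop. 4.6 ("`det L_r = det S_r`", "`S_r` … of rank `2`")] [cite: Huybrechts2016K3, Ch. 14 §0.2 Prop. 0.2] -/
theorem invariants_restrict_orthogonal_orthogonal_span_pair_of_neg_vector (hs : B.IsSymm) (he : B.IsEven)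
    (hu : B.IsUnimodular) {ℓ r : M} {d : ℤ} (hd : 0 < d) (hℓ : B ℓ ℓ = 2 * d)
    (hℓsat : ∀ (k : ℤ) (w : M), k ≠ 0 → k • w ∈ ℤ ∙ ℓ → w ∈ ℤ ∙ ℓ) (hrℓ : B r ℓ = 0) (hr : B r r = -(2 * d))
    (hrsat : ∀ (k : ℤ) (w : M), k ≠ 0 → k • w ∈ ℤ ∙ r → w ∈ ℤ ∙ r) (hdvd : ∀ w, B w ℓ = 0 → d ∣ B r w) :
    (B.restrict (B.orthogonal (B.orthogonal (Submodule.span ℤ {ℓ, r})))).Nondegenerate ∧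
    (B.restrict (B.orthogonal (B.orthogonal (Submodule.span ℤ {ℓ, r})))).IsSymm ∧
    (B.restrict (B.orthogonal (B.orthogonal (Submodule.span ℤ {ℓ, r})))).IsEven ∧
    (B.restrict (B.orthogonal (B.orthogonal (Submodule.span ℤ {ℓ, r})))).IsTwoElementary ∧
    finrank ℤ (B.orthogonal (B.orthogonal (Submodule.span ℤ {ℓ, r}))) = 2 ∧
    (B.restrict (B.orthogonal (B.orthogonal (Submodule.span ℤ {ℓ, r})))).signature = 0 ∧
    (B.restrict (B.orthogonal (B.orthogonal (Submodule.span ℤ {ℓ, r})))).length =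
      (B.restrict (B.orthogonal (Submodule.span ℤ {ℓ, r}))).length ∧
    ∀ h₁ h₂ h₃ h₁' h₂' h₃', (B.restrict (B.orthogonal (B.orthogonal (Submodule.span ℤ {ℓ, r})))).deltaInvariant h₁ h₂ h₃ =
      (B.restrict (B.orthogonal (Submodule.span ℤ {ℓ, r}))).deltaInvariant h₁' h₂' h₃' := by
  haveI : B.IsPerfPair := hu
  have hKnd := nondegenerate_restrict_orthogonal_span_pair_of_neg_vector B hs he hu hd hℓ hℓsat hrℓ hr hrsat hdvd
  have hKprim : ∀ (k : ℤ) (x : M), k ≠ 0 → k • x ∈ B.orthogonal (Submodule.span ℤ {ℓ, r}) →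
      x ∈ B.orthogonal (Submodule.span ℤ {ℓ, r}) := fun k x hk hx ↦ mem_orthogonal_of_smul_mem B _ hk hx
  obtain ⟨-, hlen, -, hδ, -⟩ := invariants_restrict_orthogonal B (B.orthogonal (Submodule.span ℤ {ℓ, r})) hs he
    hKprim hKnd
  exact ⟨nondegenerate_restrict_orthogonal B _ hs hKprim hKnd, hs.restrict _, isEven_restrict he _,
    isTwoElementary_restrict_orthogonal_orthogonal_span_pair_of_neg_vector B hs he hu hd hℓ hℓsat hrℓ hr hrsat hdvd,
    finrank_orthogonal_orthogonal_span_pair B hs hd.ne' hℓ hrℓ hr hKnd,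
    signature_restrict_orthogonal_orthogonal_span_pair B hs hd hℓ hrℓ hr hKnd, hlen.symm, fun _ _ _ _ _ _ ↦ hδ.symm⟩

/-- **GHS, proof of Prop. 4.6, `div(r) = 2d`: `S_r ≅ U`** ("`L_r` and `S_r` are isomorphic to the unique unimodular
lattices of signatures `(2,18)` and `(1,1)` respectively: … `S_r ≅ U`"), for any even unimodular `Λ`.
[cite: GritsenkoHulekSankaran2007Kodaira, §4 (arXiv numbering) proof of Prop. 4.6] [cite: Serre1973, Ch. V §2.2 Thm. 5] -/
theorem restrict_orthogonal_orthogonal_span_pair_equivalent_hyperbolicSum_one (hs : B.IsSymm) (he : B.IsEven)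
    (hu : B.IsUnimodular) {ℓ r : M} {d : ℤ} (hd : 0 < d) (hℓ : B ℓ ℓ = 2 * d)
    (hℓsat : ∀ (k : ℤ) (w : M), k ≠ 0 → k • w ∈ ℤ ∙ ℓ → w ∈ ℤ ∙ ℓ) (hrℓ : B r ℓ = 0) (hr : B r r = -(2 * d))
    (hrsat : ∀ (k : ℤ) (w : M), k ≠ 0 → k • w ∈ ℤ ∙ r → w ∈ ℤ ∙ r) (h2d : ∀ w, B w ℓ = 0 → 2 * d ∣ B r w) :
    (B.restrict (B.orthogonal (B.orthogonal (Submodule.span ℤ {ℓ, r})))).Equivalent (hyperbolicSum 1) := by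
  have hdvd : ∀ w, B w ℓ = 0 → d ∣ B r w := fun w hw ↦ (dvd_mul_left d 2).trans (h2d w hw)
  obtain ⟨hSn, hSs, hSe, -, hSrk, hSσ, hSℓ, -⟩ :=
    invariants_restrict_orthogonal_orthogonal_span_pair_of_neg_vector B hs he hu hd hℓ hℓsat hrℓ hr hrsat hdvd
  have hKℓ := (length_restrict_orthogonal_span_pair_eq_zero_iff B hs he hu hd hℓ hℓsat hrℓ hr hrsat hdvd).2 h2d
  exact equivalent_hyperbolicSum_one_of_length_eq_zero _ hSn hSs hSe hSrk hSσ (hSℓ.trans hKℓ)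

/-- **GHS, proof of Prop. 4.6, `div(r) = d`: `S_r ≅ U(2)` if `δ_{S_r} = 0`, `S_r ≅ ⟨2⟩ ⊕ ⟨−2⟩` if `δ_{S_r} = 1`**
("for an indefinite lattice `S_r` of rank `2` and determinant `4`"), for any even unimodular `Λ`; here `δ` is read
on `L_r` (`δ(S_r) = δ(L_r)`), matching the alternatives of `restrict_orthogonal_span_pair_equivalent_of_deltaInvariant`.
[cite: GritsenkoHulekSankaran2007Kodaira, §4 (arXiv numbering) proof of Prop. 4.6] [cite: AlexeevNikulin2006, §9.2] -/
theorem restrict_orthogonal_orthogonal_span_pair_equivalent_of_not_two_mul_dvd (hs : B.IsSymm) (he : B.IsEven)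
    (hu : B.IsUnimodular) {ℓ r : M} {d : ℤ} (hd : 0 < d) (hℓ : B ℓ ℓ = 2 * d)
    (hℓsat : ∀ (k : ℤ) (w : M), k ≠ 0 → k • w ∈ ℤ ∙ ℓ → w ∈ ℤ ∙ ℓ) (hrℓ : B r ℓ = 0) (hr : B r r = -(2 * d))
    (hrsat : ∀ (k : ℤ) (w : M), k ≠ 0 → k • w ∈ ℤ ∙ r → w ∈ ℤ ∙ r) (hdvd : ∀ w, B w ℓ = 0 → d ∣ B r w)
    (hndvd : ¬ ∀ w, B w ℓ = 0 → 2 * d ∣ B r w) :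
    (∀ h₁ h₂ h₃, (B.restrict (B.orthogonal (Submodule.span ℤ {ℓ, r}))).deltaInvariant h₁ h₂ h₃ = 0 →
      (B.restrict (B.orthogonal (B.orthogonal (Submodule.span ℤ {ℓ, r})))).Equivalent ((2 : ℤ) • hyperbolicSum 1)) ∧
    (∀ h₁ h₂ h₃, (B.restrict (B.orthogonal (Submodule.span ℤ {ℓ, r}))).deltaInvariant h₁ h₂ h₃ = 1 →
      (B.restrict (B.orthogonal (B.orthogonal (Submodule.span ℤ {ℓ, r})))).Equivalent
        (BilinForm.prod ((2 : ℤ) • ((1 : ℤ) • LinearMap.mul ℤ ℤ)) ((2 : ℤ) • ((-1 : ℤ) • LinearMap.mul ℤ ℤ)))) ∧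
    ((B.restrict (B.orthogonal (B.orthogonal (Submodule.span ℤ {ℓ, r})))).Equivalent ((2 : ℤ) • hyperbolicSum 1) ∨
      (B.restrict (B.orthogonal (B.orthogonal (Submodule.span ℤ {ℓ, r})))).Equivalent
        (BilinForm.prod ((2 : ℤ) • ((1 : ℤ) • LinearMap.mul ℤ ℤ)) ((2 : ℤ) • ((-1 : ℤ) • LinearMap.mul ℤ ℤ)))) := by
  obtain ⟨hSn, hSs, hSe, hS2, hSrk, hSσ, hSℓ, hSδ⟩ :=
    invariants_restrict_orthogonal_orthogonal_span_pair_of_neg_vector B hs he hu hd hℓ hℓsat hrℓ hr hrsat hdvd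
  have hKnd := nondegenerate_restrict_orthogonal_span_pair_of_neg_vector B hs he hu hd hℓ hℓsat hrℓ hr hrsat hdvd
  have hKℓ := (length_restrict_orthogonal_span_pair_eq_two_iff B hs he hu hd hℓ hℓsat hrℓ hr hrsat hdvd).2 hndvd
  have hℓ2 := hSℓ.trans hKℓ
  have h0 : ∀ h₁ h₂ h₃, (B.restrict (B.orthogonal (Submodule.span ℤ {ℓ, r}))).deltaInvariant h₁ h₂ h₃ = 0 →
      (B.restrict (B.orthogonal (B.orthogonal (Submodule.span ℤ {ℓ, r})))).Equivalent ((2 : ℤ) • hyperbolicSum 1) :=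
    fun h₁ h₂ h₃ hδ ↦ hS2.equivalent_two_smul_hyperbolicSum_one _ hSn hSs hSe hSrk hSσ hℓ2
      ((hSδ hSn hSs hSe h₁ h₂ h₃).trans hδ)
  have h1 : ∀ h₁ h₂ h₃, (B.restrict (B.orthogonal (Submodule.span ℤ {ℓ, r}))).deltaInvariant h₁ h₂ h₃ = 1 →
      (B.restrict (B.orthogonal (B.orthogonal (Submodule.span ℤ {ℓ, r})))).Equivalent
        (BilinForm.prod ((2 : ℤ) • ((1 : ℤ) • LinearMap.mul ℤ ℤ)) ((2 : ℤ) • ((-1 : ℤ) • LinearMap.mul ℤ ℤ))) :=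
    fun h₁ h₂ h₃ hδ ↦ hS2.equivalent_two_smul_one_prod_two_smul_neg_one _ hSn hSs hSe hSrk hSσ hℓ2
      ((hSδ hSn hSs hSe h₁ h₂ h₃).trans hδ)
  refine ⟨h0, h1, ?_⟩
  rcases (B.restrict (B.orthogonal (Submodule.span ℤ {ℓ, r}))).deltaInvariant_eq_zero_or_eq_one hKnd (hs.restrict _)
    (isEven_restrict he _) with hδ | hδ
  · exact Or.inl (h0 _ _ _ hδ)
  · exact Or.inr (h1 _ _ _ hδ)

end Literature.Topology.FourManifolds
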